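import Summits.AtomisticToContinuum.Crystallization.Theorems.FrustratedLawDichotomyCellF1Lists
import Summits.AtomisticToContinuum.Crystallization.Theorems.FrustratedLawDichotomyCellF1cLabels

/-!
# FrustratedLawDichotomy · crux `AperiodicFrustratedLawGap` (stmt-AtomisticToContinuum-27623) — class-A K-file tower, layer 2d-c:
the NEAR LISTS over the COMPLETE template `MF1c` as filtered label lists, and the list-free metric conversions (KFILE amendment E2/E4 «#97 lists over
MF1c (MI/MN/ML identical)», critic r1861; decomp-a2c hand-2 g48)

#89 `…CellF1Lists` RE-BASED on #106 `MF1c`: for ANY integer radius `ℓ` and centre `c` the (261) near list `ballL MF1c zT ℓ c` is the `toFinset` of the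
filtered LIST `ballF1c ℓ c := labF1c.filter (sqT (· − c) < ℓ)` (kernel-enumerable; `ballL_MF1c_eq`), with `Nodup`, the sum / `∀` bridges and the punctured
variant `ballF1c'` (the doors' `MN := (ballL M zT ℓ_N 0).erase 0`); and the METRIC CONVERSIONS at F1's Gershgorin constant `2/5`: a complete label NOT in the
`ℓ`-ball about the root / about `c` is at distance `≥ L` whenever `L² ≤ (1 − 3ε)·(2/5)·ℓ` (`far_of_not_mem_ballF1c`, `dist_of_not_mem_ballF1c`).  As amendment
E4 notes, for the interior dials (`ℓ_N, ℓ_D, ℓ_n, ℓ_r` ≪ the window) these lists have the SAME members as #89's — only the ambient label set changed.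
Imports TREE #89 `…CellF1Lists` + #106 `…CellF1cLabels`; 0 sorry.  Tags: [new: K-file layer]; nothing here closes an item.
-/

namespace Summit.AtomisticToContinuum.Crystallization.Theorems.FrustratedLawDichotomyCellF1cLists

open scoped BigOperators
open Summit.AtomisticToContinuum.Crystallization.Theorems.FrustratedLawDichotomyCellMetric (posL)
open Summit.AtomisticToContinuum.Crystallization.Theorems.FrustratedLawDichotomyCellClasses (ballL ballL_subset le_of_not_mem_ballL)
open Summit.AtomisticToContinuum.Crystallization.Theorems.FrustratedLawDichotomyCellTriples (zT sumT sqT subT mem_ballL_zT)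
open Summit.AtomisticToContinuum.Crystallization.Theorems.FrustratedLawDichotomyCellLinSep (le_norm_of_linRadius le_dist_of_linRadius)
open Summit.AtomisticToContinuum.Crystallization.Theorems.FrustratedLawDichotomyCellF1Frame (T t_rows)
open Summit.AtomisticToContinuum.Crystallization.Theorems.FrustratedLawDichotomyCellF1cLabels (labF1c MF1c mem_Mc mem_labF1c labF1c_nodup)

/-! ## §1 Near lists as filtered lists -/

/-- the `ℓ`-ball of labels about `c`, as a filtered LIST of the enumerated labels. -/
def ballF1c (ℓ : ℤ) (c : ℤ × ℤ × ℤ) : List (ℤ × ℤ × ℤ) := labF1c.filter fun x => decide (sqT (subT x c) < ℓ)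

/-- the same without the centre (the doors' `MN`/`ML` shape `(ballL M zT ℓ 0).erase 0`). -/
def ballF1c' (ℓ : ℤ) (c : ℤ × ℤ × ℤ) : List (ℤ × ℤ × ℤ) := labF1c.filter fun x => decide (sqT (subT x c) < ℓ ∧ x ≠ c)

/-- membership in the list ball. -/
theorem mem_ballF1c {ℓ : ℤ} {c x : ℤ × ℤ × ℤ} : x ∈ ballF1c ℓ c ↔ x ∈ labF1c ∧ sqT (subT x c) < ℓ := by
  simp [ballF1c, List.mem_filter]

/-- membership in the punctured list ball. -/
theorem mem_ballF1c' {ℓ : ℤ} {c x : ℤ × ℤ × ℤ} : x ∈ ballF1c' ℓ c ↔ x ∈ labF1c ∧ sqT (subT x c) < ℓ ∧ x ≠ c := by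
  simp [ballF1c', List.mem_filter]

/-- the list balls have no duplicates. -/
theorem ballF1c_nodup (ℓ : ℤ) (c : ℤ × ℤ × ℤ) : (ballF1c ℓ c).Nodup := labF1c_nodup.filter _

/-- the punctured list balls have no duplicates. -/
theorem ballF1c'_nodup (ℓ : ℤ) (c : ℤ × ℤ × ℤ) : (ballF1c' ℓ c).Nodup := labF1c_nodup.filter _

/-- ★ the (261) near list of the COMPLETE F1 label set IS the filtered list. -/
theorem ballL_MF1c_eq (ℓ : ℤ) (c : ℤ × ℤ × ℤ) : ballL MF1c zT ℓ c = (ballF1c ℓ c).toFinset := by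
  ext x
  simp only [mem_ballL_zT, List.mem_toFinset, mem_ballF1c, mem_Mc, mem_labF1c]

/-- ★ the punctured near list `(ballL MF1c zT ℓ c).erase c` IS the punctured filtered list. -/
theorem ballL_MF1c_erase_eq (ℓ : ℤ) (c : ℤ × ℤ × ℤ) : (ballL MF1c zT ℓ c).erase c = (ballF1c' ℓ c).toFinset := by
  ext x
  simp only [Finset.mem_erase, mem_ballL_zT, List.mem_toFinset, mem_ballF1c', mem_Mc, mem_labF1c]
  tauto

/-- sums over a near list are list sums. -/
theorem sum_ballL_MF1c {β : Type*} [AddCommMonoid β] (ℓ : ℤ) (c : ℤ × ℤ × ℤ) (f : ℤ × ℤ × ℤ → β) :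
    ∑ m ∈ ballL MF1c zT ℓ c, f m = ((ballF1c ℓ c).map f).sum := by
  rw [ballL_MF1c_eq, List.sum_toFinset _ (ballF1c_nodup ℓ c)]

/-- sums over a punctured near list are list sums. -/
theorem sum_ballL_MF1c_erase {β : Type*} [AddCommMonoid β] (ℓ : ℤ) (c : ℤ × ℤ × ℤ) (f : ℤ × ℤ × ℤ → β) :
    ∑ m ∈ (ballL MF1c zT ℓ c).erase c, f m = ((ballF1c' ℓ c).map f).sum := by
  rw [ballL_MF1c_erase_eq, List.sum_toFinset _ (ballF1c'_nodup ℓ c)]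

/-- `∀` over a near list is a list fact. -/
theorem forall_ballL_MF1c {ℓ : ℤ} {c : ℤ × ℤ × ℤ} {P : ℤ × ℤ × ℤ → Prop} :
    (∀ m ∈ ballL MF1c zT ℓ c, P m) ↔ ∀ m ∈ ballF1c ℓ c, P m := by
  simp only [ballL_MF1c_eq, List.mem_toFinset]

/-- `∀` over a punctured near list is a list fact. -/
theorem forall_ballL_MF1c_erase {ℓ : ℤ} {c : ℤ × ℤ × ℤ} {P : ℤ × ℤ × ℤ → Prop} :
    (∀ m ∈ (ballL MF1c zT ℓ c).erase c, P m) ↔ ∀ m ∈ ballF1c' ℓ c, P m := by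
  simp only [ballL_MF1c_erase_eq, List.mem_toFinset]

/-! ## §2 Metric conversions (list-free; F1's Gershgorin constant `2/5`) -/

/-- ★ a label outside the `ℓ`-ball about the ROOT is at distance `≥ L` from the origin under every `F` of the strain cell, whenever
`L² ≤ (1 − 3ε)·(2/5)·ℓ` (the `hfarL`/`hMNc`/`hMLc` conversions of the master for `MN`/`ML`). -/
theorem far_of_not_mem_ballF1cc {F : Matrix (Fin 3) (Fin 3) ℝ} (hG : ∀ i j, |(F.transpose * F) i j - (if i = j then 1 else 0)| ≤ 1 / 1024)
    {L : ℝ} {ℓ : ℤ} (hL : L ^ 2 ≤ (1 - 3 * (1 / 1024)) * (2 / 5) * ℓ) {m : ℤ × ℤ × ℤ} (hm : m ∈ MF1c)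
    (hn : m ∉ ballL MF1c zT ℓ (0 : ℤ × ℤ × ℤ)) : L ≤ ‖posL F (T.mulVec fun j => (zT m j : ℝ))‖ := by
  have hz := le_of_not_mem_ballL hm hn
  have h0 : ∀ i, zT (0 : ℤ × ℤ × ℤ) i = 0 := by intro i; fin_cases i <;> rfl
  simp only [h0, sub_zero] at hz
  exact le_norm_of_linRadius hG (by norm_num) T t_rows (by norm_num) hL hz

/-- ★ a label outside the `ℓ`-ball about a label `c` is at distance `≥ L` from `a_F c` (the `nb`/`nbr` side conditions). -/
theorem dist_of_not_mem_ballF1cc {F : Matrix (Fin 3) (Fin 3) ℝ} (hG : ∀ i j, |(F.transpose * F) i j - (if i = j then 1 else 0)| ≤ 1 / 1024)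
    {L : ℝ} {ℓ : ℤ} (hL : L ^ 2 ≤ (1 - 3 * (1 / 1024)) * (2 / 5) * ℓ) {c m : ℤ × ℤ × ℤ} (hm : m ∈ MF1c) (hn : m ∉ ballL MF1c zT ℓ c) :
    L ≤ dist (posL F (T.mulVec fun j => (zT m j : ℝ))) (posL F (T.mulVec fun j => (zT c j : ℝ))) :=
  le_dist_of_linRadius hG (by norm_num) T t_rows (by norm_num) hL (le_of_not_mem_ballL hm hn)

end Summit.AtomisticToContinuum.Crystallization.Theorems.FrustratedLawDichotomyCellF1cLists
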